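import Summits.ABC.IUTFork.Charitable.Thm311D1PerPlaceHullCertified
import HarnessLib

/-!
# Branch D, team D1 — ADVERSARY ADDENDUM to p444083 / p445135 / p445902 (abc-iut-D1-cx gen 3): the volume side of the fine pinned model, and
no honest-volume countermodel at a place-certified operator

Proof-only file (D-0012; abc-iut cell, rung LADDER-ABC:A2.D; team D1 ADVERSARY second read of abc-iut-D1-prv gen 3's `Thm311D1PerPlaceFinePinned`
(p444083, (δ′-iii) «per-place ∧ THREE PINS ∧ ¬S»), `Thm311D1PerPlaceFineHull` (p445135, S_H at that model) and `Thm311D1PerPlaceHullCertified`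
(p445902, S_H at every place-certified operator); NO definition, NO `Prop` fact; everything consumed BY NAME). TAKES NO SIDE on [IUTchIII]
Cor. 3.12 or on any author.

(A) THE CLASS IS CANONICAL, AND IT IS A NO-GO FOR THE TEAM'S DELIVERABLE (b) («per-place ∧ pins ∧ ¬Statement» at an honest instantiation).
`placeCertified_iff_placeSeparable`: p445902's `PlaceCertified S ρ` ⟺ the cover form «`ρ(X) ⊆ ⋃_v ρ(Y_v)` for EVERY family `(Y_v)` with
`Y_v(v) = X(v)`» — so the surface «is `PlaceCertified` the right class?» has a kernel answer: it is the only one (its negation = «some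
placewise-agreeing family fails to cover», the shape a place-COUPLING former must have). `statement_of_perPlace_of_placeCertified`: abc-iut-c312-6's
`BridgeHyps` + (pΘ) ∧ (pq′) + per-place square ⟹ Cor. 3.12's `Statement` at every place-certified operator (p445902's licence composed with
`statement_of_licence`) — any situation, setting, datum; for Kit III's `fineRegion` over EVERY lattice situation on the sign-shell carrier, every
choice of admissibility / log-volumes / splitting monoids / degrees / columns (`statement_of_perPlace_pinned_fineRegion`, `…_fine`). Hence for the
operator of (δ′) the per-place reading admits NO countermodel to the Corollary's inequality under the bridge hypotheses — by theorem; (δ′-iii) is,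
and can only be, an identification-level (`¬S`) exhibit; a volume-level one needs a NON-place-certified former
(`not_placeCertified_of_perPlace_pinned_not_licence`), the case p445902's HONEST SCOPE leaves undecided for print's former (Rmk. 3.9.5).
(B) VOLUME CENSUS OF THE FINE PINNED MODEL (p444083's HONEST SCOPE «no volume clause», made quantitative). At (`fineFull1`, `fineSetting`, `fineRegion`,
`sepDatumSub`) the pilot regions at the labels `j ∈ 𝔽_l^⋇` miss `0` (`zero_not_mem_fineSetting_qRegion/_thetaHull`), so they are no cylinders and
carry the model's default log-volume `0`: `−|log(q)| = 0`, `−|log(Θ)| = 0` (`fineSetting_negLogQ/_negLogTheta`); Cor. 3.12's `Statement` HOLDS there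
(`fineSetting_statement`, `0 ≤ 0`), «`|log(q)| > 0`» FAILS (`fineSetting_not_absLogQPos`), the bridge hypotheses FAIL (`fineSetting_not_bridgeHyps`:
`∅` is a hull-set of the discrete frame) and the log-volume is NOT monotone on the enlarged admissible family (`fineSetting_not_logvolMono`, `c ≠ 0`:
`B_{±1} ⊆ 𝓘^ℚ`, `μ(B_{±1}) = ∓c`, `μ(𝓘^ℚ) = 0`). READING (grades untouched): the typed Thm. 3.11 (i) (a) puts no axiom on `𝕄(…)` / `μ^log`
(`Thm311.MRData.Adm/.logvol` are bare fields), so p444083's «every region admissible» is legitimate AS TYPED; what the enlargement leaves is exactly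
abc-iut-c312-6's bridge (monotone volumes on admissible regions, nonempty hull-sets — print: Prop. 3.9 (i)–(iii), Rmk. 3.9.5); (δ′-iii) separates S from
«per-place ∧ THREE PINS» at REGION level only, and by (A) no model with `ρ = fineRegion` can do more. (INFO) p444083's glue is object-blind
(`fineSetting_glue_objectBlind`) — harmless: the typed setting reads the glue at the pilots only. [claim: Mochizuki2012, status: disputed]
Standard axioms; typed ≠ proved; audited ≠ endorsed.
-/


noncomputable section

open Set

namespace Summit.ABC.IUTFork.Charitable

open Thm311 Cor312 Cor312Vol Literature.IUT.LogThetaLattice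

variable {T : ThetaIndex}

/-! ## A. The class of p445902 is the canonical one; per-place ∧ pins ⟹ Statement under the bridge hypotheses at place-certified operators -/

section NoGo

variable (S : LatticeSituation T) (P : Cor312.Setting S.toSituation)
  (ρ : (∀ v : T.V, v ∈ T.Vbad → Set (S.L.StarPacket v)) → ∀ (j : T.Label) (vQ : T.VQ), Set (S.L.Packet j vQ))
  (qK : ∀ v : T.V, v ∈ T.Vbad → Set (S.L.StarPacket v))

/-- **`PlaceCertified` (p445902) is the canonical class: it is EQUIVALENT to PLACE-SEPARABILITY** — the `ρ`-region of a datum `X` is covered by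
the `ρ`-regions of EVERY family of data `(Y_v)_{v ∈ 𝕍^bad}` with `Y_v(v) = X(v)` (the cover form an adversary would state; `→` pointwise, `←` by
choosing, for a point certified at no place, a refuting datum at every place). So «not place-certified» = «some placewise-agreeing family fails to
cover», the exact shape a place-COUPLING former must have to escape §A. [folklore] -/
theorem placeCertified_iff_placeSeparable :
    PlaceCertified S ρ ↔
      ∀ (X : ∀ v : T.V, v ∈ T.Vbad → Set (S.L.StarPacket v))
        (Y : ∀ v : T.V, v ∈ T.Vbad → ∀ w : T.V, w ∈ T.Vbad → Set (S.L.StarPacket w)),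
        (∀ (v : T.V) (hv : v ∈ T.Vbad), Y v hv v hv = X v hv) →
          ∀ (j : T.Label) (vQ : T.VQ), ρ X j vQ ⊆ ⋃ (v : T.V) (hv : v ∈ T.Vbad), ρ (Y v hv) j vQ := by
  classical
  refine ⟨fun h X Y hY j vQ t ht => ?_, fun h X j vQ t ht => ?_⟩
  · obtain ⟨v, hv, hcert⟩ := h X j vQ t ht
    exact Set.mem_iUnion₂.2 ⟨v, hv, hcert (Y v hv) (hY v hv)⟩
  · by_contra hne
    push Not at hne
    choose Y hYX hYt using hne
    obtain ⟨v, hv, htv⟩ := Set.mem_iUnion₂.1 (h X Y hYX j vQ ht)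
    exact hYt v hv htv

/-- **NO-GO for the team's deliverable (b) at place-certified operators.** Bridge hypotheses (abc-iut-c312-6) + (pΘ) ∧ (pq′) + the PER-PLACE square
⟹ Cor. 3.12's `Statement` (p445902 `licence_of_perPlace_of_placeCertified` composed with `Thm311ToCor312.statement_of_licence`): no
honest-volume instantiation carries «per-place ∧ pins ∧ ¬Statement» at such an operator — any situation, setting, datum. [claim: Mochizuki2012, status: disputed] -/
theorem statement_of_perPlace_of_placeCertified (H : BridgeHyps P) (hpin : PinnedRegions S P ρ qK) (hcert : PlaceCertified S ρ)
    (hC : PerPlaceKummerCompat S P qK) : P.Statement :=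
  Thm311ToCor312.statement_of_licence H (licence_of_perPlace_of_placeCertified S P ρ qK hpin hcert hC)

/-- Contrapositive, the adversary's target shape: a model of «(pΘ) ∧ (pq′) ∧ per-place square ∧ ¬Licence» (in particular any ¬S_H exhibit under
the pins) has an operator that is NOT place-certified — it must couple the data of two bad places over one `v_ℚ`. [folklore] -/
theorem not_placeCertified_of_perPlace_pinned_not_licence (hpin : PinnedRegions S P ρ qK) (hC : PerPlaceKummerCompat S P qK)
    (h : ¬ Thm311ToCor312.Licence P) : ¬ PlaceCertified S ρ := fun hcert =>
  h (licence_of_perPlace_of_placeCertified S P ρ qK hpin hcert hC)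

end NoGo

/-- **`fineRegion` over EVERY lattice situation on the sign-shell carrier** (any data (a)(b)(c) — admissibility, log-volumes, splitting monoids —
any global degrees, any columns), ANY setting over it, ANY q-datum: bridge hypotheses + (pΘ) ∧ (pq′) + per-place square ⟹ Cor. 3.12's `Statement`.
So **deliverable (b) is impossible by theorem for `ρ = fineRegion`**: (δ′-iii) (p444083) is, and can only be, an identification-level exhibit.
[claim: Mochizuki2012, status: disputed] -/
theorem statement_of_perPlace_pinned_fineRegion (D : ℤ → MRData (NaiveProv.signShells T))
    (G : ∀ (n : ℤ) (j : T.LabelStar), GlobalDegrees (NaiveProv.signShells T) j) (col : ℤ → Column (NaiveProv.signShells T))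
    (P : Cor312.Setting ({ L := NaiveProv.signShells T, D := D, G := G } : Situation T))
    (qK : ∀ v : T.V, v ∈ T.Vbad → Set ((NaiveProv.signShells T).StarPacket v)) (H : BridgeHyps P)
    (hpin : PinnedRegions ({ L := NaiveProv.signShells T, D := D, G := G, col := col } : LatticeSituation T) P fineRegion qK)
    (hper : PerPlaceKummerCompat ({ L := NaiveProv.signShells T, D := D, G := G, col := col } : LatticeSituation T) P qK) :
    P.Statement :=
  statement_of_perPlace_of_placeCertified ({ L := NaiveProv.signShells T, D := D, G := G, col := col } : LatticeSituation T) P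
    fineRegion qK H hpin fineRegion_placeCertified hper

/-- The instance over p444083's fine situations (`fineFullOf θ`, ANY setting, ANY datum): bridge hypotheses + two pins + per-place ⟹ `Statement`.
[claim: Mochizuki2012, status: disputed] -/
theorem statement_of_perPlace_pinned_fine (p : ℕ) (vQ₀ : T.VQ) (c : ℝ) (θ : NaiveProv.ThetaFamily T)
    (P : Cor312.Setting (fineSituationOf p vQ₀ c θ))
    (qK : ∀ v : T.V, v ∈ T.Vbad → Set ((NaiveProv.signShells T).StarPacket v)) (H : BridgeHyps P)
    (hpin : PinnedRegions (fineFullOf p vQ₀ c θ).toLatticeSituation P fineRegion qK)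
    (hper : PerPlaceKummerCompat (fineFullOf p vQ₀ c θ).toLatticeSituation P qK) : P.Statement :=
  statement_of_perPlace_of_placeCertified (fineFullOf p vQ₀ c θ).toLatticeSituation P fineRegion qK H hpin fineRegion_placeCertified hper

/-! ## B. The volume side of the fine pinned model -/

section Volumes

variable (p : ℕ) [hp : Fact p.Prime]

/-- At a label `j ≠ 0` the fine region of the theta data misses `0` (a theta vector has the coordinate `±q^{j²} ≠ 0` along its own place).
[folklore] -/
theorem zero_not_mem_fineRegion_psi {j : T.Label} (hj : j ≠ 0) (vQ : T.VQ) :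
    (0 : (NaiveProv.signShells T).Packet j vQ) ∉
      fineRegion (fun (u : T.V) (_ : u ∈ T.Vbad) => NaiveProv.PsiOf (NaiveProv.thetaVec1 p) u) j vQ := by
  intro h
  obtain ⟨u, hu, huQ, ψ, hψ, hc⟩ := (mem_fineRegion_iff hj).1 h
  subst huQ
  obtain ⟨s, hss, hψj⟩ := exists_smul_of_mem_PsiOf p hψ ⟨j, hj⟩
  have h0 := hc fun _ => T.toFibre u
  rw [map_zero, rebase_self, hψj, map_smul, smul_eq_mul] at h0
  erw [coordTuple_thetaVec1, if_pos rfl] at h0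
  have hs : s ≠ 0 := fun hs0 => by rw [hs0, mul_zero] at hss; exact zero_ne_one hss
  exact mul_ne_zero hs (pow_ne_zero _ (Nat.cast_ne_zero.mpr hp.out.ne_zero)) h0.symm

omit hp in
/-- The model's log-volume vanishes on every region missing `0` (no cylinder `B_k` misses `0`; away from `v_ℚ⁰` everything is `0`). [folklore] -/
theorem naiveVol_eq_zero_of_zero_not_mem [Fact p.Prime] (vQ₀ : T.VQ) (c : ℝ) {j : T.Label} {vQ : T.VQ}
    {A : Set ((NaiveProv.signShells T).Packet j vQ)} (hA : (0 : (NaiveProv.signShells T).Packet j vQ) ∉ A) :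
    NaiveProv.vol p vQ₀ c j vQ A = 0 := by
  by_cases hvQ : vQ = vQ₀
  · subst hvQ
    rw [NaiveProv.vol_self]
    unfold NaiveProv.ballVol
    rw [dif_neg]
    rintro ⟨k, rfl⟩
    exact hA (NaiveProv.zero_mem_pBall p j vQ k)
  · exact NaiveProv.vol_of_ne p vQ₀ c hvQ A

omit hp in
/-- The model's log-volume of a whole packet is `0` (no cylinder is everything). [folklore] -/
theorem naiveVol_univ [Fact p.Prime] (vQ₀ : T.VQ) (c : ℝ) (j : T.Label) (vQ : T.VQ) :
    NaiveProv.vol p vQ₀ c j vQ (Set.univ : Set ((NaiveProv.signShells T).Packet j vQ)) = 0 := by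
  by_cases hvQ : vQ = vQ₀
  · subst hvQ
    rw [NaiveProv.vol_self]
    unfold NaiveProv.ballVol
    rw [dif_neg]
    rintro ⟨k, hk⟩
    exact NaiveProv.pBall_ne_univ p j vQ k hk.symm
  · exact NaiveProv.vol_of_ne p vQ₀ c hvQ _

variable (v : T.V) (hv : v ∈ T.Vbad) (c : ℝ) (v' : T.V)

/-- **The q-pilot region misses `0`** at every label `j ≠ 0` (it lies in the orbit-union of the fine regions of the theta data, p445135). [folklore] -/
theorem zero_not_mem_fineSetting_qRegion {j : T.Label} (hj : j ≠ 0) (vQ : T.VQ) :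
    (0 : (NaiveProv.signShells T).Packet j vQ) ∉ (fineSetting p v hv c v').qRegion j vQ := by
  intro h0
  rw [fineSetting_qRegion] at h0
  obtain ⟨Φ, -, s, hs, hΦs⟩ := Set.mem_iUnion₂.1
    (fineRegion_subset_iUnion_of_perPlace (sepDatumSub_perPlace_psi p v v') j vQ h0)
  rw [(Φ j vQ).map_eq_zero_iff] at hΦs
  subst hΦs
  exact zero_not_mem_fineRegion_psi p hj vQ hs

/-- **The holomorphic hull `ⁿ˒°𝒰_{j,v_ℚ}` misses `0`** at every label `j ≠ 0` (it is the union of the indeterminacy-translates of the fine region of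
the theta data, p445135 `fineSetting_thetaHull`). [folklore] -/
theorem zero_not_mem_fineSetting_thetaHull {j : T.Label} (hj : j ≠ 0) (vQ : T.VQ) :
    (0 : (NaiveProv.signShells T).Packet j vQ) ∉ (fineSetting p v hv c v').thetaHull j vQ := by
  intro h0
  rw [fineSetting_thetaHull] at h0
  obtain ⟨U, hU, hU0⟩ := Set.mem_sUnion.1 h0
  obtain ⟨Φ, -, rfl⟩ := hU
  obtain ⟨s, hs, hΦs⟩ := hU0
  rw [(Φ j vQ).map_eq_zero_iff] at hΦs
  subst hΦs
  obtain ⟨m, hm⟩ := Set.mem_iUnion.1 hs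
  rw [fineSetting_thetaRegion, fineFull1_frobΨ] at hm
  exact zero_not_mem_fineRegion_psi p hj vQ hm

/-- `−|log(q)|`'s local terms all vanish. [folklore] -/
theorem fineSetting_qLocal (i : Fin T.lstar) (vQ : T.VQ) : (fineSetting p v hv c v').qLocal (Setting.labelSucc i) vQ = 0 :=
  naiveVol_eq_zero_of_zero_not_mem p (T.over v) c
    (zero_not_mem_fineSetting_qRegion p v hv c v' (Setting.labelSucc_ne_zero i) vQ)

/-- **`−|log(q)| = 0`** at the fine pinned model. [folklore] -/
theorem fineSetting_negLogQ : (fineSetting p v hv c v').negLogQ = 0 := by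
  unfold Setting.negLogQ
  simp only [fineSetting_qLocal, finsum_zero]
  exact processionNormalized_const (lt_of_lt_of_le two_pos T.two_le_lstar) 0

/-- **«`|log(q)| > 0`» FAILS** at the fine pinned model. [folklore] -/
theorem fineSetting_not_absLogQPos : ¬ (fineSetting p v hv c v').AbsLogQPos := by
  unfold Setting.AbsLogQPos
  rw [fineSetting_negLogQ]
  exact lt_irrefl 0

omit hp in
/-- In the discrete frame every union of possible images «admits its hull». [folklore] -/
theorem fineSetting_hullDefined (j : T.Label) (vQ : T.VQ) : (fineSetting p v hv c v').HullDefined j vQ := ⟨trivial, trivial⟩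

omit hp in
/-- (INFO) **The glue of `fineSetting` is object-blind**: every lgp-object of the column at `(0,m)` is assigned the region of the Θ-pilot, every
`△`-object the region of the q-pilot (w4-d026's setting of record scales `B_{k·j²}` with the object `k`). Harmless for every typed clause: the setting
reads the glue at the pilot objects only (`Setting.thetaRegion`, `Setting.qRegion`). [folklore] -/
theorem fineSetting_glue_objectBlind (m : ℤ) (a b : (fineSetting p v hv c v').Ob (fineSetting p v hv c v').sig.Clgp)
    (x y : (fineSetting p v hv c v').ObΔ) :
    (fineSetting p v hv c v').thetaRegionOf m a = (fineSetting p v hv c v').thetaRegionOf m b ∧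
      (fineSetting p v hv c v').qRegionOf x = (fineSetting p v hv c v').qRegionOf y := ⟨rfl, rfl⟩

/-- `−|log(Θ)|`'s local terms all vanish. [folklore] -/
theorem fineSetting_thetaLocal (i : Fin T.lstar) (vQ : T.VQ) :
    (fineSetting p v hv c v').thetaLocal (Setting.labelSucc i) vQ = ((0 : ℝ) : WithTop ℝ) := by
  unfold Setting.thetaLocal
  rw [if_pos (fineSetting_hullDefined p v hv c v' _ vQ)]
  congr 1
  exact naiveVol_eq_zero_of_zero_not_mem p (T.over v) c
    (zero_not_mem_fineSetting_thetaHull p v hv c v' (Setting.labelSucc_ne_zero i) vQ)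

/-- «`−|log(Θ)|` is finite» holds at the fine pinned model. [folklore] -/
theorem fineSetting_thetaFinite : (fineSetting p v hv c v').ThetaFinite := by
  refine ⟨fun i vQ => ?_, fun i => Set.finite_empty.subset fun vQ hvQ => ?_⟩
  · rw [fineSetting_thetaLocal]
    exact WithTop.coe_ne_top
  · simp [fineSetting_thetaLocal] at hvQ

/-- **`−|log(Θ)| = 0`** at the fine pinned model. [folklore] -/
theorem fineSetting_negLogTheta : (fineSetting p v hv c v').negLogTheta = ((0 : ℝ) : WithTop ℝ) := by
  unfold Setting.negLogTheta
  rw [if_pos (fineSetting_thetaFinite p v hv c v')]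
  congr 1
  simp only [fineSetting_thetaLocal, WithTop.untopD_coe, finsum_zero]
  exact processionNormalized_const (lt_of_lt_of_le two_pos T.two_le_lstar) 0

/-- **Cor. 3.12's `Statement` HOLDS at the fine pinned model — trivially, `0 ≤ 0`** (so (δ′-iii) is no countermodel to the inequality). [folklore] -/
theorem fineSetting_statement : (fineSetting p v hv c v').Statement := by
  refine ⟨?_, ?_⟩
  · rw [fineSetting_negLogTheta]
    exact WithTop.coe_ne_top
  · rw [fineSetting_negLogTheta, fineSetting_negLogQ]

omit hp in
/-- **The bridge hypotheses FAIL** at the fine pinned model: the empty set is a hull-set of the discrete frame. [folklore] -/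
theorem fineSetting_not_bridgeHyps : ¬ BridgeHyps (fineSetting p v hv c v') := fun H =>
  Set.not_nonempty_empty (H.hul_nonempty 0 (T.over v) ∅ (Set.mem_univ _))

/-- **The log-volume is NOT monotone on the enlarged admissible family** («everything admissible»): `B_1 ⊆ 𝓘^ℚ`, `B_{−1} ⊆ 𝓘^ℚ`, but
`μ(B_{±1}) = ∓c` while `μ(𝓘^ℚ) = 0` (a whole packet is no cylinder) — for `c ≠ 0` one of the two inclusions decreases the volume. [folklore] -/
theorem fineSetting_not_logvolMono (hc : c ≠ 0) : ¬ LogvolMono (fineSetting p v hv c v') := by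
  intro hmono
  have i0 : Fin T.lstar := ⟨0, lt_of_lt_of_le two_pos T.two_le_lstar⟩
  have key : ∀ k : ℤ, NaiveProv.vol p (T.over v) c (Setting.labelSucc i0) (T.over v)
      (NaiveProv.pBall p (Setting.labelSucc i0) (T.over v) k) ≤ 0 := fun k => by
    have h := hmono i0 (T.over v) (A := NaiveProv.pBall p (Setting.labelSucc i0) (T.over v) k) (B := Set.univ)
      trivial trivial (Set.subset_univ _)
    have hu := naiveVol_univ p (T.over v) c (Setting.labelSucc i0) (T.over v)
    exact h.trans_eq hu
  have h1 := key 1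
  have h2 := key (-1)
  rw [NaiveProv.vol_self_pBall] at h1 h2
  push_cast at h1 h2
  rcases lt_or_gt_of_ne hc with hneg | hpos
  · linarith
  · linarith

/-- **VOLUME CENSUS CERTIFICATE for (δ′-iii)** (two distinct bad places over one rational place): at the fine pinned model the typed Thm. 3.11
holds, the THREE PINS and the PER-PLACE square hold and S FAILS (p444083) — while Cor. 3.12's `Statement` HOLDS (`−|log(Θ)| = −|log(q)| = 0`),
«`|log(q)| > 0`» FAILS and the bridge hypotheses FAIL. [claim: Mochizuki2012, status: disputed] -/
theorem perPlace_pinned3_fine_volume_census {v v' : T.V} (hv : v ∈ T.Vbad) (hv' : v' ∈ T.Vbad) (hne : v ≠ v')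
    (hover : T.over v' = T.over v) :
    (fineFull1 p (T.over v) c).Statement ∧
    PinnedRegions3 (fineFull1 p (T.over v) c).toLatticeSituation (fineSetting p v hv c v') fineRegion (sepDatumSub p v v') ∧
    PerPlaceKummerCompat (fineFull1 p (T.over v) c).toLatticeSituation (fineSetting p v hv c v') (sepDatumSub p v v') ∧
    ¬ PilotKummerIndRelated (fineFull1 p (T.over v) c).toLatticeSituation (fineSetting p v hv c v') fineRegion (sepDatumSub p v v') ∧
    (fineSetting p v hv c v').Statement ∧ (fineSetting p v hv c v').negLogTheta = ((0 : ℝ) : WithTop ℝ) ∧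
    (fineSetting p v hv c v').negLogQ = 0 ∧ ¬ (fineSetting p v hv c v').AbsLogQPos ∧ ¬ BridgeHyps (fineSetting p v hv c v') :=
  ⟨fineFull1_statement p (T.over v) c, fineSetting_pinnedRegions3 p v hv c v', sepDatumSub_perPlace_fine p v hv c v',
    sepDatumSub_not_S_finePinned p c hv hv' hne hover, fineSetting_statement p v hv c v', fineSetting_negLogTheta p v hv c v',
    fineSetting_negLogQ p v hv c v', fineSetting_not_absLogQPos p v hv c v', fineSetting_not_bridgeHyps p v hv c v'⟩

omit hp in
/-- **Closed instance** at `twoBadIndex` (`q = 2`, `c = 1`): ONE typed-Thm-3.11 situation with a pinned setting where per-place ∧ THREE PINS ∧ ¬S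
hold TOGETHER WITH Cor. 3.12's `Statement`, `¬ AbsLogQPos` and `¬ BridgeHyps`. [claim: Mochizuki2012, status: disputed] -/
theorem perPlace_pinned3_fine_volume_census_instance :
    ∃ (T : ThetaIndex) (S : FullSituation T) (P : Cor312.Setting S.toLatticeSituation.toSituation)
      (ρ : (∀ v : T.V, v ∈ T.Vbad → Set (S.L.StarPacket v)) → ∀ (j : T.Label) (vQ : T.VQ), Set (S.L.Packet j vQ))
      (qK : ∀ v : T.V, v ∈ T.Vbad → Set (S.L.StarPacket v)),
      S.Statement ∧ PinnedRegions3 S.toLatticeSituation P ρ qK ∧ PerPlaceKummerCompat S.toLatticeSituation P qK ∧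
      ¬ PilotKummerIndRelated S.toLatticeSituation P ρ qK ∧ P.Statement ∧ ¬ P.AbsLogQPos ∧ ¬ BridgeHyps P := by
  haveI : Fact (Nat.Prime 2) := ⟨Nat.prime_two⟩
  obtain ⟨h0, h1, h2, h3, h4, -, -, h5, h6⟩ := perPlace_pinned3_fine_volume_census (T := twoBadIndex) 2 1 (v := true) (v' := false)
    trivial trivial (show (true : Bool) ≠ false by decide) rfl
  exact ⟨twoBadIndex, fineFull1 2 (twoBadIndex.over true) 1, fineSetting (T := twoBadIndex) 2 true trivial 1 false, fineRegion,
    sepDatumSub (T := twoBadIndex) 2 true false, h0, h1, h2, h3, h4, h5, h6⟩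

end Volumes

end Summit.ABC.IUTFork.Charitable

end
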